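import Literature.AlgebraicGeometry.HodgeTheory.FermatSurfacePlaneSections
import Literature.AlgebraicGeometry.HodgeTheory.FermatSurfaceLineClassesEquivariance
import Literature.AlgebraicGeometry.HodgeTheory.HyperplaneClassRestrictionNonzero
import HarnessLib

/-!
# The hyperplane class of the Fermat surface as a uniform sum of line classes, and the restrictions of the line classes to a line

Family `hodge`, layer `Literature/AlgebraicGeometry/HodgeTheory`. PROOF FILE (theorems only; no
definition, no named fact). On the Fermat surface `X = X²ₘ ⊂ ℙ³_ℂ` with its `m²` lines
`L(u, u') : x₀ = u x₁, x₂ = u' x₃` (`uᵐ = u'ᵐ = -1`; `FermatSurfaceLines`, `FermatSurfacePlaneSections`,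
`FermatSurfaceLineClassesEquivariance`) and a hyperplane-type class `h = ι^* r`
(`r ∈ H²(ℙ³(ℂ); ℂ)`), everything for the COMPLEX orientation family:

* `FermatSurface.restrictCompl_planeLines_map_hypersurfaceι` — `h` dies off every plane section
  `X ∩ {x₀ = u x₁} = ⋃_{u'} L(u, u')` (and `X ∩ {x₂ = u' x₃}`): `H²(ℙ³) = ℂ · T^* r₀` for the
  re-embedding `T : ℙ³ ↪ ℙ⁴` of the plane, and `(ι ≫ T)^* r₀` dies there (contractible chart);
* `FermatSurface.hyperplane_eq_smul_sum_left/right` — **`h = S • Σ_{u'} cl L(u, u')` for EVERY `u`,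
  with one scalar `S`** (and symmetrically in the other slope): Deligne's Cor. 8.2.8 gives
  `h = Σ s_{u'} cl L(u₀, u')` for one plane, the symmetries `(1, u/u₀, 1, η)` carry it to
  `h = Σ s_{u'} cl L(u, u' η)` (`g^* h = h`, `g^* cl L = cl g⁻¹L`), and averaging over `η ∈ μₘ` makes
  the coefficient uniform (in print: `H ∼ Σ_{u'} L(u, u')`, the plane section is the sum of its `m`
  lines, each with multiplicity one);
* `FermatSurface.line_restrictions` — **the restrictions to `L₀ = L(u₀, u₀')` of the line classes**:
  with `η = g_{L₀}^* h ≠ 0` (a hyperplane class restricts non-trivially to a line) there are `t ≠ 0`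
  and `κ ∈ ℕ` with `g_{L₀}^* cl L(u, u₀') = t η` (`u ≠ u₀`), `g_{L₀}^* cl L(u₀, u') = t η` (`u' ≠ u₀'`)
  and `g_{L₀}^* cl L₀ = (1 - κ) t η` — the cohomological shadow of the intersection numbers
  `L · L' = 1` for meeting lines and `L² = 2 - m` (Shioda 1979 §1; Ran, Compositio Math. 42 (1980)
  Prop. 1.14: the intersection matrix of the lines; Hartshorne V Ex. 4.16 for `m = 3`), obtained
  WITHOUT local intersection multiplicities by restricting the two uniform relations to `L₀` and
  solving (`(1 + κ)(S - S') = 0`).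

## References

* [Shioda1979HodgeFermat] T. Shioda, The Hodge conjecture for Fermat varieties, Math. Ann. 245 (1979), §1.
* [Ran1980] Z. Ran, Cycles on Fermat hypersurfaces, Compositio Math. 42 (1980), §1 Prop. 1.14.
* [Hartshorne1977] R. Hartshorne, Algebraic Geometry (1977), V Ex. 4.16, V Prop. 1.4.
* [DeligneHodgeIII1974] P. Deligne, Théorie de Hodge III, Cor. 8.2.8.
* [VoisinHodgeI2002] C. Voisin, Hodge Theory I, §7.1.2, §11.1.2 (hyperplane / Kähler class).
-/

noncomputable section

open scoped LinearAlgebra.Projectivization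
open CategoryTheory AlgebraicGeometry MvPolynomial
open Literature.AlgebraicGeometry.Motives Literature.AlgebraicTopology.SingularHomology
open Literature.NumberTheory.Transcendental

namespace Literature.AlgebraicGeometry.HodgeTheory

namespace FermatSurface

variable {m : ℕ}

/-! ### Slope pairs of the plane sections -/

/-- The lines of the plane `x₀ = u x₁` have slope pairs `(u, u')`. [folklore] -/
theorem planeLine_zero_eq (u u' : ℂ) : planeLine 0 u u' = pair u u' :=
  _root_.funext (Fin.forall_fin_two.mpr ⟨by simp [planeLine], by simp [planeLine]⟩)

/-- The lines of the plane `x₂ = u' x₃` have slope pairs `(u, u')`. [folklore] -/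
theorem planeLine_one_eq (u u' : ℂ) : planeLine 1 u' u = pair u u' :=
  _root_.funext (Fin.forall_fin_two.mpr ⟨by simp [planeLine], by simp [planeLine]⟩)

/-! ### The hyperplane class dies off every plane section and restricts non-trivially to every line -/

/-- `H²(ℙᴺ(ℂ); ℂ) ≠ 0` for `N ≥ 1`. [cite: HatcherAT2002, Thm. 3.19] -/
theorem exists_complexBetti_projectiveSpace_ne_zero (N : ℕ) (hN : 1 ≤ N) :
    ∃ r : complexBetti (Motives.projectiveSpace N ℂ) (2 * 1), r ≠ 0 := by
  have h1 := finrank_complexBetti_projectiveSpace_two_mul_eq_one N (p := 1) hN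
  haveI : Nontrivial (complexBetti (Motives.projectiveSpace N ℂ) (2 * 1)) :=
    Module.nontrivial_of_finrank_pos (R := ℂ) (by omega)
  exact exists_ne 0

/-- **The hyperplane class `ι^* r` dies off every plane section `⋃ᵤ L`** of `X²ₘ` by a plane
`x_{2q} = v x_{2q+1}`: with `T : ℙ³ ↪ ℙ⁴` the re-embedding of the plane, `H²(ℙ³(ℂ); ℂ) = ℂ · T^* r₀`
(`dim = 1`, `T^* r₀ ≠ 0`), and `(ι ≫ T)^* r₀` dies off the section
(`restrictCompl_planeLines_map_planeEmb`). [cite: Hartshorne1977, V Prop. 1.4] [cite: HatcherAT2002, Thm. 3.19] -/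
theorem restrictCompl_planeLines_map_hypersurfaceι (hm : 1 ≤ m) (q : Fin 2) {v : ℂ} (hv : v ^ m = -1)
    (r : complexBetti (Motives.projectiveSpace (2 * 1 + 1) ℂ) (2 * 1)) :
    complexBetti.restrictCompl (fermatHypersurface (2 * 1) m) (⋃ u : negRoots m, Set.range
      (lineEmb m (planeLine q v u) (planeLine_pow q hv (pow_eq_of_mem_negRoots hm u))).left.base)
      (2 * 1) (complexBetti.map (SmoothHypersurface.hypersurfaceι (fermatPolynomial ℂ (2 * 1) m)) (2 * 1) r) = 0 := by
  obtain ⟨r₀, hr₀⟩ := exists_complexBetti_projectiveSpace_ne_zero 4 (by norm_num)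
  set T : Motives.projectiveSpace (2 * 1 + 1) ℂ ⟶ Motives.projectiveSpace 4 ℂ :=
    ProjectiveSpace.linSubstMap (planeSubst q v) (isHomogeneous_planeSubst q v) (exists_planeSubst_eq_X q v)
    with hT
  haveI : IsClosedImmersion T.left := ProjectiveSpace.isClosedImmersion_linSubstMap_left _ _ _
  have hT0 : complexBetti.map T (2 * 1) r₀ ≠ 0 :=
    complexBetti_map_two_ne_zero_of_isClosedImmersion (isSmoothProjective_projectiveSpace' (2 * 1 + 1))
      (by norm_num) T hr₀
  have h1 := finrank_complexBetti_projectiveSpace_two_mul_eq_one (2 * 1 + 1) (p := 1) (by norm_num)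
  obtain ⟨c, hc⟩ := (finrank_eq_one_iff_of_nonzero' _ hT0).mp h1 r
  have hcomp : complexBetti.map (SmoothHypersurface.hypersurfaceι (fermatPolynomial ℂ (2 * 1) m)) (2 * 1) (complexBetti.map T (2 * 1) r₀) =
      complexBetti.map (planeEmb m q v) (2 * 1) r₀ := by
    rw [planeEmb, complexBetti.map_comp]
    rfl
  rw [← hc, map_smul, map_smul, hcomp, restrictCompl_planeLines_map_planeEmb hm q hv r₀, smul_zero]

/-- **The hyperplane class is a linear combination of the line classes of any plane section.**
[cite: DeligneHodgeIII1974, Cor. 8.2.8] [cite: Hartshorne1977, V Prop. 1.4] -/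
theorem exists_hyperplane_eq_sum_smul_lineClass (μ : OrientationFamily) (hm : 1 ≤ m) (q : Fin 2) {v : ℂ}
    (hv : v ^ m = -1) (r : complexBetti (Motives.projectiveSpace (2 * 1 + 1) ℂ) (2 * 1)) :
    ∃ s : negRoots m → ℂ, complexBetti.map (SmoothHypersurface.hypersurfaceι (fermatPolynomial ℂ (2 * 1) m)) (2 * 1) r = ∑ u, s u •
      lineClass μ m (planeLine q v u) (planeLine_pow q hv (pow_eq_of_mem_negRoots hm u)) hm :=
  exists_eq_sum_smul_lineClass μ hm q hv _ (restrictCompl_planeLines_map_hypersurfaceι hm q hv r)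

/-- **A non-zero class of `H²(ℙ³(ℂ))` restricts non-trivially to every line of the Fermat surface**
(`L ↪ X ↪ ℙ³` is a closed immersion of a positive-dimensional smooth variety; the Kähler-class argument
of the tree's `complexBetti_map_two_ne_zero_of_isClosedImmersion`). [cite: VoisinHodgeI2002, §3.3.2 Lemma 3.16 and the remark following it, §7.1.2] -/
theorem map_lineEmb_map_hypersurfaceι_ne_zero (w : Fin 2 → ℂ) (hw : ∀ q, w q ^ m = -1)
    {r : complexBetti (Motives.projectiveSpace (2 * 1 + 1) ℂ) (2 * 1)} (hr : r ≠ 0) :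
    complexBetti.map (lineEmb m w hw) (2 * 1) (complexBetti.map (SmoothHypersurface.hypersurfaceι (fermatPolynomial ℂ (2 * 1) m)) (2 * 1) r) ≠ 0 := by
  rw [← CategoryTheory.comp_apply, ← complexBetti.map_comp]
  exact complexBetti_map_two_ne_zero_of_isClosedImmersion (isSmoothProjective_projectiveSpace' 1) le_rfl
    (lineEmb m w hw ≫ (SmoothHypersurface.hypersurfaceι (fermatPolynomial ℂ (2 * 1) m))) hr

/-! ### Averaging over `μₘ`: the hyperplane class is a UNIFORM sum of the line classes of a plane -/

/-- **Uniform relation, first family: `ι^* r = S • Σ_{u'} cl L(u, u')` for every root `u` of `-1`,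
with one scalar `S`** (complex orientations, `m ≥ 1`). From `ι^* r = Σ s_{u'} cl L(u₀, u')`
(Cor. 8.2.8 for the plane `x₀ = u₀ x₁`), the symmetry `a = (1, u/u₀, 1, η)` gives
`ι^* r = Σ s_{u'} cl L(u, u' η)` (`g_a^* ι^* r = ι^* r`, `g_a^* cl L(w) = cl L(translate a w)`), and
summing over `η ∈ μₘ` (`|μₘ| = m`; `u' η` runs over all roots of `-1`) yields
`m ι^* r = (Σ s) Σ_{u''} cl L(u, u'')`. [cite: Shioda1979HodgeFermat, §1] [cite: Hartshorne1977, V Ex. 4.16] -/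
theorem hyperplane_eq_smul_sum_left [NeZero m] {u₀ : ℂ} (hu₀ : u₀ ^ m = -1)
    (r : complexBetti (Motives.projectiveSpace (2 * 1 + 1) ℂ) (2 * 1)) :
    ∃ S : ℂ, ∀ u : negRoots m, complexBetti.map (SmoothHypersurface.hypersurfaceι (fermatPolynomial ℂ (2 * 1) m)) (2 * 1) r = S • ∑ u' : negRoots m, lineCls m u u' := by
  have hm : 1 ≤ m := NeZero.one_le
  haveI := Fintype.ofFinite (rootsOfUnity m ℂ)
  obtain ⟨s, hs⟩ := exists_hyperplane_eq_sum_smul_lineClass complexOrientationFamily hm 0 hu₀ r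
  refine ⟨(m : ℂ)⁻¹ * ∑ u', s u', fun u ↦ ?_⟩
  have hu := pow_eq_of_mem_negRoots hm u
  -- the root of unity `ξ = u / u₀`
  have hu₀0 := ne_zero_of_pow_eq_neg_one hm hu₀
  have hξ1 : (Units.mk0 ((u : ℂ) / u₀) (div_ne_zero (ne_zero_of_pow_eq_neg_one hm hu) hu₀0)) ∈
      rootsOfUnity m ℂ := (mem_rootsOfUnity' _ _).mpr (by
    rw [Units.val_mk0, div_pow, hu, hu₀, div_self]; norm_num)
  set ξ : rootsOfUnity m ℂ := ⟨_, hξ1⟩ with hξ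
  have hξu : u₀ * ((ξ : ℂˣ) : ℂ) = u := by
    rw [hξ]; change u₀ * ((u : ℂ) / u₀) = u; field_simp
  -- for every `η`: `ι^* r = Σ s_{u'} cl L(u, u' η)`
  have key : ∀ η : rootsOfUnity m ℂ, complexBetti.map (SmoothHypersurface.hypersurfaceι (fermatPolynomial ℂ (2 * 1) m)) (2 * 1) r = ∑ u' : negRoots m, s u' •
      lineClass complexOrientationFamily m (pair u ((u' : ℂ) * ((η : ℂˣ) : ℂ)))
        (pair_pow hu (pow_eq_of_mem_negRoots hm (rootsToNegRoots hm u' η))) hm := by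
    intro η
    set a : fermatGroup (2 * 1) m := fermatGroupEquiv m ![1, ξ, 1, η] with ha
    have h := congrArg (singularCohomology.map ℂ ℂ (diagonalMap (fermatPolynomial ℂ (2 * 1) m)
      (fermatGroup_le_diagonalStabilizer m a.2)) (2 * 1)) hs
    rw [map_diagonalMap_map_hypersurfaceι, map_sum] at h
    rw [h]
    refine Finset.sum_congr rfl fun u' _ ↦ ?_
    rw [map_smul, map_diagonalMap_lineClass hm a.2]
    exact congrArg (s u' • ·) (lineClass_congr complexOrientationFamily hm
      (by rw [planeLine_zero_eq, ha, translate_pair, hξu]) _ _)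
  -- sum over `η`
  have hcard : (Finset.univ : Finset (rootsOfUnity m ℂ)).card = m := by
    rw [Finset.card_univ, ← Nat.card_eq_fintype_card, Complex.card_rootsOfUnity]
  have hsum := Finset.sum_congr rfl fun (η : rootsOfUnity m ℂ) (_ : η ∈ Finset.univ) ↦ key η
  rw [Finset.sum_const, hcard, Finset.sum_comm] at hsum
  simp_rw [← Finset.smul_sum] at hsum
  have hre : ∀ u' : negRoots m, ∑ η : rootsOfUnity m ℂ, lineClass complexOrientationFamily m (pair u ((u' : ℂ) * ((η : ℂˣ) : ℂ)))
      (pair_pow hu (pow_eq_of_mem_negRoots hm (rootsToNegRoots hm u' η))) hm =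
      ∑ u'' : negRoots m, lineClass complexOrientationFamily m (pair u u'') (pair_pow hu (pow_eq_of_mem_negRoots hm u'')) hm :=
    fun u' ↦ Fintype.sum_equiv (rootsToNegRoots hm u') _ _ fun η ↦ rfl
  simp_rw [hre, ← Finset.sum_smul] at hsum
  rw [mul_smul, ← hsum, ← Nat.cast_smul_eq_nsmul ℂ, smul_smul, inv_mul_cancel₀
    (Nat.cast_ne_zero.mpr (NeZero.ne m)), one_smul]

/-- **Uniform relation, second family: `ι^* r = S' • Σᵤ cl L(u, u')` for every root `u'` of `-1`**
(the same argument with the planes `x₂ = u' x₃` and the symmetries `(1, η, 1, u'/u₀')`).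
[cite: Shioda1979HodgeFermat, §1] [cite: Hartshorne1977, V Ex. 4.16] -/
theorem hyperplane_eq_smul_sum_right [NeZero m] {u₀' : ℂ} (hu₀' : u₀' ^ m = -1)
    (r : complexBetti (Motives.projectiveSpace (2 * 1 + 1) ℂ) (2 * 1)) :
    ∃ S : ℂ, ∀ u' : negRoots m, complexBetti.map (SmoothHypersurface.hypersurfaceι (fermatPolynomial ℂ (2 * 1) m)) (2 * 1) r = S • ∑ u : negRoots m, lineCls m u u' := by
  have hm : 1 ≤ m := NeZero.one_le
  haveI := Fintype.ofFinite (rootsOfUnity m ℂ)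
  obtain ⟨s, hs⟩ := exists_hyperplane_eq_sum_smul_lineClass complexOrientationFamily hm 1 hu₀' r
  refine ⟨(m : ℂ)⁻¹ * ∑ u, s u, fun u' ↦ ?_⟩
  have hu' := pow_eq_of_mem_negRoots hm u'
  have hu₀0 := ne_zero_of_pow_eq_neg_one hm hu₀'
  have hξ1 : (Units.mk0 ((u' : ℂ) / u₀') (div_ne_zero (ne_zero_of_pow_eq_neg_one hm hu') hu₀0)) ∈
      rootsOfUnity m ℂ := (mem_rootsOfUnity' _ _).mpr (by
    rw [Units.val_mk0, div_pow, hu', hu₀', div_self]; norm_num)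
  set ξ : rootsOfUnity m ℂ := ⟨_, hξ1⟩ with hξ
  have hξu : u₀' * ((ξ : ℂˣ) : ℂ) = u' := by
    rw [hξ]; change u₀' * ((u' : ℂ) / u₀') = u'; field_simp
  have key : ∀ η : rootsOfUnity m ℂ, complexBetti.map (SmoothHypersurface.hypersurfaceι (fermatPolynomial ℂ (2 * 1) m)) (2 * 1) r = ∑ u : negRoots m, s u •
      lineClass complexOrientationFamily m (pair ((u : ℂ) * ((η : ℂˣ) : ℂ)) u')
        (pair_pow (pow_eq_of_mem_negRoots hm (rootsToNegRoots hm u η)) hu') hm := by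
    intro η
    set a : fermatGroup (2 * 1) m := fermatGroupEquiv m ![1, η, 1, ξ] with ha
    have h := congrArg (singularCohomology.map ℂ ℂ (diagonalMap (fermatPolynomial ℂ (2 * 1) m)
      (fermatGroup_le_diagonalStabilizer m a.2)) (2 * 1)) hs
    rw [map_diagonalMap_map_hypersurfaceι, map_sum] at h
    rw [h]
    refine Finset.sum_congr rfl fun u _ ↦ ?_
    rw [map_smul, map_diagonalMap_lineClass hm a.2]
    exact congrArg (s u • ·) (lineClass_congr complexOrientationFamily hm
      (by rw [planeLine_one_eq, ha, translate_pair, hξu]) _ _)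
  have hcard : (Finset.univ : Finset (rootsOfUnity m ℂ)).card = m := by
    rw [Finset.card_univ, ← Nat.card_eq_fintype_card, Complex.card_rootsOfUnity]
  have hsum := Finset.sum_congr rfl fun (η : rootsOfUnity m ℂ) (_ : η ∈ Finset.univ) ↦ key η
  rw [Finset.sum_const, hcard, Finset.sum_comm] at hsum
  simp_rw [← Finset.smul_sum] at hsum
  have hre : ∀ u : negRoots m, ∑ η : rootsOfUnity m ℂ, lineClass complexOrientationFamily m (pair ((u : ℂ) * ((η : ℂˣ) : ℂ)) u')
      (pair_pow (pow_eq_of_mem_negRoots hm (rootsToNegRoots hm u η)) hu') hm =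
      ∑ u'' : negRoots m, lineClass complexOrientationFamily m (pair u'' u') (pair_pow (pow_eq_of_mem_negRoots hm u'') hu') hm :=
    fun u ↦ Fintype.sum_equiv (rootsToNegRoots hm u) _ _ fun η ↦ rfl
  simp_rw [hre, ← Finset.sum_smul] at hsum
  rw [mul_smul, ← hsum, ← Nat.cast_smul_eq_nsmul ℂ, smul_smul, inv_mul_cancel₀
    (Nat.cast_ne_zero.mpr (NeZero.ne m)), one_smul]

/-! ### The restrictions of the line classes to a line -/

/-- For `m ≥ 2` there is a second root of `-1` besides `u₀`. [folklore] -/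
theorem exists_negRoot_ne (hm : 2 ≤ m) {u₀ : ℂ} (hu₀ : u₀ ^ m = -1) : ∃ u : negRoots m, (u : ℂ) ≠ u₀ := by
  have hm1 : 1 ≤ m := by omega
  have hζ := Complex.isPrimitiveRoot_exp m (by omega)
  set ζ := Complex.exp (2 * Real.pi * Complex.I / m) with hζdef
  have hζ1 : ζ ≠ 1 := hζ.ne_one hm
  refine ⟨⟨u₀ * ζ, (mem_negRoots hm1).mpr (by rw [mul_pow, hu₀, hζ.pow_eq_one, mul_one])⟩, ?_⟩
  change u₀ * ζ ≠ u₀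
  intro h
  apply hζ1
  have hu0 := ne_zero_of_pow_eq_neg_one hm1 hu₀
  calc ζ = u₀ * ζ / u₀ := by field_simp
    _ = 1 := by rw [h, div_self hu0]

/-- **The restrictions of the line classes to `L₀ = L(u₀, u₀')`** (complex orientations, `m ≥ 2`,
`h = ι^* r` with `r ≠ 0`, `η = g_{L₀}^* h ≠ 0`): there are `t ≠ 0` and `κ ∈ ℕ` such that for every
`a ∈ μₘ⁴` the class of `a⁻¹ · L₀ = L(u₀ a₁/a₀, u₀' a₃/a₂)` restricts to
`g_{L₀}^* cl(a⁻¹ L₀) = c(a) η` with `c(a) = (1 - κ) t` if `a₀ = a₁` and `a₂ = a₃` (the line `L₀`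
itself), `c(a) = t` if exactly one of `a₀ = a₁`, `a₂ = a₃` holds (a line meeting `L₀` in one point),
`c(a) = 0` otherwise (a skew line). In print: `L₀² = 2 - m`, `L · L₀ = 1`, `L · L₀ = 0` (Ran Prop. 1.14;
Hartshorne V Ex. 4.16). Proof: restrict the uniform relations `h = S Σ_{u'} cl L(u, u')`,
`h = S' Σᵤ cl L(u, u')` to `L₀`: for `u ≠ u₀` only `L(u, u₀')` survives, giving `S ≠ 0` and the value
`S⁻¹ η` (similarly `S'⁻¹ η`); for `u = u₀` one gets `cl L₀|_{L₀} = (S⁻¹ - κ S'⁻¹) η = (S'⁻¹ - κ S⁻¹) η`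
with `κ + 1` the number of roots of `-1`, whence `S = S'`.
[cite: Ran1980, §1 Prop. 1.14] [cite: Hartshorne1977, V Ex. 4.16] [cite: Shioda1979HodgeFermat, §1] -/
theorem line_restrictions [NeZero m] (hm : 2 ≤ m) {u₀ u₀' : ℂ} (hu₀ : u₀ ^ m = -1) (hu₀' : u₀' ^ m = -1)
    {r : complexBetti (Motives.projectiveSpace (2 * 1 + 1) ℂ) (2 * 1)} (hr : r ≠ 0) :
    ∃ (t : ℂ) (κ : ℕ), t ≠ 0 ∧
      complexBetti.map (lineEmb m (pair u₀ u₀') (pair_pow hu₀ hu₀')) (2 * 1)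
        (complexBetti.map (SmoothHypersurface.hypersurfaceι (fermatPolynomial ℂ (2 * 1) m)) (2 * 1) r) ≠ 0 ∧
      ∀ (a : Fin (2 * 1 + 2) → ℂˣ) (ha : a ∈ fermatGroup (2 * 1) m),
        complexBetti.map (lineEmb m (pair u₀ u₀') (pair_pow hu₀ hu₀')) (2 * 1)
          (lineClass complexOrientationFamily m (translate a (pair u₀ u₀')) (translate_pow ha (pair_pow hu₀ hu₀')) NeZero.one_le) =
        (if a 0 = a 1 then (if a 2 = a 3 then (1 - (κ : ℂ)) * t else t) else (if a 2 = a 3 then t else 0)) •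
          complexBetti.map (lineEmb m (pair u₀ u₀') (pair_pow hu₀ hu₀')) (2 * 1)
            (complexBetti.map (SmoothHypersurface.hypersurfaceι (fermatPolynomial ℂ (2 * 1) m)) (2 * 1) r) := by
  have hm1 : 1 ≤ m := NeZero.one_le
  -- notation
  set ρ := complexBetti.map (lineEmb m (pair u₀ u₀') (pair_pow hu₀ hu₀')) (2 * 1) with hρ
  set η := ρ (complexBetti.map (SmoothHypersurface.hypersurfaceι (fermatPolynomial ℂ (2 * 1) m)) (2 * 1) r) with hη
  have hη0 : η ≠ 0 := map_lineEmb_map_hypersurfaceι_ne_zero _ _ hr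
  set R := negRoots m with hR
  set b : R := ⟨u₀, (mem_negRoots hm1).mpr hu₀⟩ with hb
  set b' : R := ⟨u₀', (mem_negRoots hm1).mpr hu₀'⟩ with hb'
  -- skew lines restrict to zero
  have hskew : ∀ u u' : R, (u : ℂ) ≠ u₀ → (u' : ℂ) ≠ u₀' → ρ (lineCls m u u') = 0 := fun u u' hu hu' ↦
    map_lineEmb_lineClass_eq_zero complexOrientationFamily _ _ hm1 (by simpa using hu) (by simpa using hu')
  -- the two uniform relations, restricted to `L₀`
  obtain ⟨S, hS⟩ := hyperplane_eq_smul_sum_left (m := m) hu₀ r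
  obtain ⟨S', hS'⟩ := hyperplane_eq_smul_sum_right (m := m) hu₀' r
  have hV : ∀ u : R, (u : ℂ) ≠ u₀ → η = S • ρ (lineCls m u b') := by
    intro u hu
    have h := congrArg ρ (hS u)
    rw [map_smul, map_sum, Finset.sum_eq_single b' (fun u' _ hu' ↦ hskew u u' hu
      (fun h' ↦ hu' (Subtype.ext h'))) (fun h' ↦ absurd (Finset.mem_univ _) h')] at h
    exact h
  have hU : ∀ u' : R, (u' : ℂ) ≠ u₀' → η = S' • ρ (lineCls m b u') := by
    intro u' hu'
    have h := congrArg ρ (hS' u')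
    rw [map_smul, map_sum, Finset.sum_eq_single b (fun u _ hu ↦ hskew u u'
      (fun h' ↦ hu (Subtype.ext h')) hu') (fun h' ↦ absurd (Finset.mem_univ _) h')] at h
    exact h
  -- `S, S' ≠ 0` (there is a second root of `-1`)
  obtain ⟨u₁, hu₁⟩ := exists_negRoot_ne hm hu₀
  obtain ⟨u₁', hu₁'⟩ := exists_negRoot_ne hm hu₀'
  have hS0 : S ≠ 0 := by
    intro h0; have h := hV u₁ hu₁; rw [h0, zero_smul] at h; exact hη0 h
  have hS0' : S' ≠ 0 := by
    intro h0; have h := hU u₁' hu₁'; rw [h0, zero_smul] at h; exact hη0 h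
  have hV' : ∀ u : R, (u : ℂ) ≠ u₀ → ρ (lineCls m u b') = S⁻¹ • η := fun u hu ↦ by
    rw [hV u hu, inv_smul_smul₀ hS0]
  have hU' : ∀ u' : R, (u' : ℂ) ≠ u₀' → ρ (lineCls m b u') = S'⁻¹ • η := fun u' hu' ↦ by
    rw [hU u' hu', inv_smul_smul₀ hS0']
  -- the plane through `L₀`: `S⁻¹ η = σ + κ S'⁻¹ η` and symmetrically
  set κ : ℕ := (Finset.univ.erase b').card with hκ
  have hκ' : (Finset.univ.erase b).card = κ := by
    rw [hκ, Finset.card_erase_of_mem (Finset.mem_univ _), Finset.card_erase_of_mem (Finset.mem_univ _)]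
  have hσ1 : ρ (lineCls m b b') = S⁻¹ • η - (κ : ℂ) • S'⁻¹ • η := by
    have h := congrArg ρ (hS b)
    rw [map_smul, map_sum, ← Finset.add_sum_erase _ _ (Finset.mem_univ b'),
      Finset.sum_congr rfl (fun u' hu' ↦ hU' u' (fun h' ↦ (Finset.mem_erase.mp hu').1 (Subtype.ext h'))),
      Finset.sum_const, ← hκ, ← Nat.cast_smul_eq_nsmul ℂ] at h
    rw [← hη] at h
    have h2 : S⁻¹ • η = ρ (lineCls m b b') + (κ : ℂ) • S'⁻¹ • η := by
      conv_lhs => rw [h]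
      rw [inv_smul_smul₀ hS0]
    rw [h2, add_sub_cancel_right]
  have hσ2 : ρ (lineCls m b b') = S'⁻¹ • η - (κ : ℂ) • S⁻¹ • η := by
    have h := congrArg ρ (hS' b')
    rw [map_smul, map_sum, ← Finset.add_sum_erase _ _ (Finset.mem_univ b),
      Finset.sum_congr rfl (fun u hu ↦ hV' u (fun h' ↦ (Finset.mem_erase.mp hu).1 (Subtype.ext h'))),
      Finset.sum_const, hκ', ← Nat.cast_smul_eq_nsmul ℂ] at h
    rw [← hη] at h
    have h2 : S'⁻¹ • η = ρ (lineCls m b b') + (κ : ℂ) • S⁻¹ • η := by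
      conv_lhs => rw [h]
      rw [inv_smul_smul₀ hS0']
    rw [h2, add_sub_cancel_right]
  -- hence `S = S'`
  have hSS : S⁻¹ = S'⁻¹ := by
    have h : ((1 + (κ : ℂ)) * (S⁻¹ - S'⁻¹)) • η = 0 := by
      have h' : (S⁻¹ : ℂ) • η - (κ : ℂ) • S'⁻¹ • η - (S'⁻¹ • η - (κ : ℂ) • S⁻¹ • η) = 0 := by
        rw [← hσ1, ← hσ2, sub_self]
      rw [← h', smul_smul, smul_smul, ← sub_smul, ← sub_smul, ← sub_smul]
      congr 1
      ring
    have h1k : (1 + (κ : ℂ)) ≠ 0 := by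
      rw [add_comm]
      exact_mod_cast Nat.succ_ne_zero κ
    rcases smul_eq_zero.mp h with h | h
    · exact sub_eq_zero.mp ((mul_eq_zero.mp h).resolve_left h1k)
    · exact absurd h hη0
  refine ⟨S⁻¹, κ, inv_ne_zero hS0, hη0, fun a ha ↦ ?_⟩
  -- classification of `a⁻¹ · L₀`
  have hmem0 : u₀ * ((a 1 / a 0 : ℂˣ) : ℂ) ∈ R := (mem_negRoots hm1).mpr
    (by rw [mul_pow, hu₀, coe_div_pow_eq_one ha, mul_one])
  have hmem1 : u₀' * ((a 3 / a 2 : ℂˣ) : ℂ) ∈ R := (mem_negRoots hm1).mpr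
    (by rw [mul_pow, hu₀', coe_div_pow_eq_one ha, mul_one])
  have hcl : lineClass complexOrientationFamily m (translate a (pair u₀ u₀')) (translate_pow ha (pair_pow hu₀ hu₀')) hm1 =
      lineCls m ⟨_, hmem0⟩ ⟨_, hmem1⟩ := lineClass_congr complexOrientationFamily hm1 (translate_pair_eq a u₀ u₀') _ _
  have hu00 := ne_zero_of_pow_eq_neg_one hm1 hu₀
  have hu00' := ne_zero_of_pow_eq_neg_one hm1 hu₀'
  have key0 : u₀ * ((a 1 / a 0 : ℂˣ) : ℂ) = u₀ ↔ a 0 = a 1 := by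
    rw [mul_eq_left₀ hu00, Units.val_eq_one, div_eq_one, eq_comm]
  have key1 : u₀' * ((a 3 / a 2 : ℂˣ) : ℂ) = u₀' ↔ a 2 = a 3 := by
    rw [mul_eq_left₀ hu00', Units.val_eq_one, div_eq_one, eq_comm]
  rw [hcl]
  by_cases h01 : a 0 = a 1
  · have e0 : (⟨_, hmem0⟩ : R) = b := Subtype.ext (key0.mpr h01)
    by_cases h23 : a 2 = a 3
    · -- the line `L₀` itself
      have e1 : (⟨_, hmem1⟩ : R) = b' := Subtype.ext (key1.mpr h23)
      rw [if_pos h01, if_pos h23, e0, e1, hσ1, hSS, smul_smul, ← sub_smul]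
      congr 1
      ring
    · -- meets `L₀` at the apex of `x₀ = u₀ x₁`
      rw [if_pos h01, if_neg h23, e0, hU' _ (fun h ↦ h23 (key1.mp h)), hSS]
  · by_cases h23 : a 2 = a 3
    · -- meets `L₀` at the apex of `x₂ = u₀' x₃`
      have e1 : (⟨_, hmem1⟩ : R) = b' := Subtype.ext (key1.mpr h23)
      rw [if_neg h01, if_pos h23, e1, hV' _ (fun h ↦ h01 (key0.mp h))]
    · -- skew
      rw [if_neg h01, if_neg h23, zero_smul]
      exact hskew _ _ (fun h ↦ h01 (key0.mp h)) (fun h ↦ h23 (key1.mp h))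

end FermatSurface

end Literature.AlgebraicGeometry.HodgeTheory

end
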